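import Mathlib
import HarnessLib
import Literature.GroupTheory.PermutationGroups.JordanPrimeCycle

/-!
# Elements of prime order and prime divisors of the order of a primitive group

Topic `Literature/GroupTheory/PermutationGroups`.  Fully PROVED consequences of Jordan's `p`-cycle
theorem (`JordanPrimeCycle.lean`) for a primitive `G ≤ Sym(α)` of degree `n` not containing `Aₙ`:

* `two_mul_le_card_support_of_prime_orderOf` — an element of prime order `p ≤ n - 3` has at least
  two `p`-cycles (support of size `≥ 2p`); it is never a single `p`-cycle.
* `not_prime_dvd_card_of_lt_two_mul` — hence a prime `p` with `n/2 < p ≤ n - 3` does not divide `|G|`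
  (Cauchy + the above) — the classical "large primes" input to order bounds for primitive groups
  (Jordan 1873; used by Praeger–Saxl 1980).
* `le_half_or_le_add_two_of_prime_dvd_card` — packaged: `p ∣ |G|` forces `2p ≤ n` or `n ≤ p + 2`.
-/

namespace Literature.GroupTheory.PermutationGroups

open Equiv Equiv.Perm MulAction

variable {α : Type*} [Fintype α] [DecidableEq α] {G : Subgroup (Perm α)}

/-- In a primitive group not containing the alternating group, an element of prime order `p` with
`p + 3 ≤ n` has support of size at least `2p` (it has at least two `p`-cycles), by Jordan's
`p`-cycle theorem. [folklore] -/
theorem two_mul_le_card_support_of_prime_orderOf (hG : IsPreprimitive G α)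
    (hA : ¬ alternatingGroup α ≤ G) {x : Perm α} (hx : x ∈ G) {p : ℕ} (hp : p.Prime)
    (hord : orderOf x = p) (hp' : p + 3 ≤ Nat.card α) : 2 * p ≤ x.support.card := by
  have hprime : (orderOf x).Prime := hord ▸ hp
  obtain ⟨m, hm⟩ := cycleType_prime_order hprime
  rw [hord] at hm
  have hsum := sum_cycleType x
  rw [hm, Multiset.sum_replicate, smul_eq_mul] at hsum
  rcases Nat.eq_zero_or_pos m with rfl | hmpos
  · -- a single `p`-cycle: Jordan's theorem gives `Aₙ ≤ G`
    exfalso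
    have hcyc : x.IsCycle := by
      rw [← card_cycleType_eq_one, hm]
      simp
    have hcard : x.support.card = p := by omega
    exact hA (alternatingGroup_le_of_isPreprimitive_of_isCycle_mem hG hp hp' hcyc hcard hx)
  · rw [← hsum]
    have : 2 ≤ m + 1 := by omega
    exact Nat.mul_le_mul_right p this

/-- **Large primes do not divide the order.**  If `G ≤ Sym(α)` is primitive of degree `n`, does not
contain `Aₙ`, and `p` is a prime with `p + 3 ≤ n < 2p`, then `p ∤ |G|` (an element of order `p`
would be a single `p`-cycle). [folklore] -/
theorem not_prime_dvd_card_of_lt_two_mul (hG : IsPreprimitive G α) (hA : ¬ alternatingGroup α ≤ G)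
    {p : ℕ} (hp : p.Prime) (hp' : p + 3 ≤ Nat.card α) (hn : Nat.card α < 2 * p) :
    ¬ p ∣ Nat.card G := by
  intro hdvd
  haveI : Fact p.Prime := ⟨hp⟩
  obtain ⟨x, hx⟩ := exists_prime_orderOf_dvd_card' p hdvd
  have hord : orderOf (x : Perm α) = p := by rw [Subgroup.orderOf_coe, hx]
  have h2 := two_mul_le_card_support_of_prime_orderOf hG hA x.2 hp hord hp'
  have h3 : (x : Perm α).support.card ≤ Nat.card α := by
    rw [Nat.card_eq_fintype_card]; exact Finset.card_le_univ _
  omega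

/-- Packaged form: a prime divisor `p` of `|G|` (for `G` primitive of degree `n` not containing `Aₙ`)
satisfies `2p ≤ n` or `n ≤ p + 2`. [folklore] -/
theorem two_mul_le_or_le_add_two_of_prime_dvd_card (hG : IsPreprimitive G α)
    (hA : ¬ alternatingGroup α ≤ G) {p : ℕ} (hp : p.Prime) (hdvd : p ∣ Nat.card G) :
    2 * p ≤ Nat.card α ∨ Nat.card α ≤ p + 2 := by
  by_contra h
  push Not at h
  exact not_prime_dvd_card_of_lt_two_mul hG hA hp (by omega) (by omega) hdvd

end Literature.GroupTheory.PermutationGroups
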